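import Literature.Probability.LatticeModels.TransferOperator
import Literature.MathematicalPhysics.QuantumFieldTheory.Balaban1983to89.Setup
import Literature.MathematicalPhysics.QuantumFieldTheory.Balaban1983to89.B11SchwarzRemainder
import Literature.Analysis.OperatorTheory.YangMillsMatrixModelDiscreteSpectrum

/-!
# FemtoUniverseGap — rung R2b′ of the `ym-beyond` ladder: the femto-universe gap typed over the tree's transfer data,
# its exact position strictly between R2a and R2c, Lüscher's zero-mode asymptotics (N34) as its sufficient input, the
# leading constant `ε₁` by name from the Literature fact `LuscherSimonGap`, and the precision budget of its last step
# (N35) (cell `ym-beyond`, seat P1; README §1 rungs R2b′/R2c; bookkeeping)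

HONEST FRAMING (cell `ym-beyond`, HUMAN RULINGS D-0035 / D-0037).  The cell's ladder is framed around the full Clay
statement; rung R2b′ — «in the zero-electric-flux sector of the spacing-`a` lattice theory on a spatial torus of
physical side `ℓ` inside Bałaban's reach, Euclidean time already infinite, the physical gap is at least
`(ε₁ g(ℓ)^{2/3} − C g(ℓ)^{4/3})/ℓ` eventually in the spacing» — is a VOLUME-DEPENDENT, NON-UNIFORM lower bound: a
milestone strictly between R2a (thermodynamic limit points, `T4ThermodynamicLimit`) and R2c (a volume-uniform gap,
confinement-scale physics), and NOT the mass gap.  This module asserts NOTHING about Yang–Mills: the carrier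
`FemtoFamily` (transfer data of the tree's `Literature.Probability.LatticeModels.TransferData`, Glimm–Jaffe §6.1,
indexed by spacing and spatial volume), the rung `FemtoGap`, the node N34 `ZeroModeAsymptotics` and the node N35
`BackgroundBudget` are `Prop`s / hypothesis shapes.  What is PROVED is monotonicity and limit arithmetic
(`uniformGap_of_inf`: R2b′ ⇒ R2c iff the rate is bounded below; `femtoRate_tendsto_zero` / `not_inf_pos_femtoRate`:
inside the reach it is not; `femtoGap_eventually_of_uniformGap`: R2c ⇒ R2b′ cofinitely — so R2b′ sits STRICTLY
between; `GapRate.clustering`: time-clustering at unbounded separations, which a finite symmetric torus cannot offer;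
`femtoGap_of_asymptotics`: N34 ⇒ R2b′; `trivialTD_gapNorm` / `not_gapRate_trivialFamily`: the free zero mode is
transfer data with no gap, so the rung is not vacuous), the order-2 Schwarz step of the budget
(`norm_sub_apply_zero_le_of_deriv_eq_zero`, from the tree's `B11SchwarzRemainder`), `BackgroundBudget.spread`,
`not_backgroundBudget_linear`, `kkMass_scaled`, and the BY-NAME link to the Literature fact
`Literature.Analysis.OperatorTheory.YMMatrixModel.LuscherSimonGap` (KNOWN: Simon 1983 Cor. 4 + Reed–Simon XIII; a
hypothesis here, never proved in the tree): it supplies `0 < luscherEps1`, whence the femto reach at `ε₁ =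
luscherEps1` is exactly «coupling in Bałaban's interval and Lüscher's parameter below `luscherEps1 / C`»
(`femtoReach_luscher_iff`, `femtoGap_luscher_of_asymptotics`).  Value = kernel bookkeeping of the rung ⇐ named inputs;
NOT summit progress.  Companion memo: `run/shared/lean/pub/ym-beyond/ROUTE-P1.md` §§14, 17, 18 (refereed, cell
referee baseline v0.7).

Printed context (page-cited in the memo; quoted for CONTEXT only).  Lüscher's femto-universe expansion
[Luscher1983]: on a spatial torus of side `ℓ` small against the confinement scale the low-lying spectrum of the
zero-flux sector is `E(ℓ) = ε₁ λ/ℓ + O(λ²/ℓ)`, `λ = g(ℓ)^{2/3}`, with `ε₁` an eigenvalue gap of the zero-momentum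
matrix Hamiltonian `−½Δ + ¼Σ|x_i × x_j|²` on gauge-invariant `L²(ℝ⁹)` [LuscherMunster1984]; discreteness of that
spectrum is [SimonB1983DiscreteSpectrum] (tree fact `LuscherSimonGap`).  The k-uniform bounds behind N35 are B12 =
[Balaban1987RG1] (0.28)–(0.30) p. 258–259 and the analyticity domains (1.11)–(1.16) p. 262–263 (verbatim in §4's
docstring); the shrinking small-field windows are [Balaban1988Convergent] (1.1) p. 246.

Sections.  §1 the carrier and the rung (`HTransfer`, `FemtoFamily`, `GapRate`, `UniformGap`, `femtoRate`,
`FemtoGap`, `femtoReach`, `ZeroModeAsymptotics`) with the theorems listed above; §2 non-vacuity (the free zero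
mode); §3 `ε₁` by name from `LuscherSimonGap`; §4 the precision budget and N35 `BackgroundBudget`, `kkMass_scaled`.
-/

open Filter Topology

namespace Literature.MathematicalPhysics.QuantumFieldTheory.Balaban1983to89.FemtoUniverseGap

open Literature.Probability.LatticeModels

/-! ## §1 R2b′ — the femto-universe gap, a typed rung strictly between R2a and R2c

`HTransfer` bundles a Hilbert space with the tree's `TransferData` (transfer matrix `T = e^{-aH}` + vacuum, Glimm–Jaffe §6.1,
`Literature/Probability/LatticeModels/TransferOperator.lean`), so that a family indexed by (spacing index `j`, spatial-volume
index `n`) may vary the space.  `FemtoFamily` is THE CARRIER of R2b′: `X j n` = transfer data of the spacing-`a j` lattice theory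
on the SPATIAL torus of physical side `side n`, Euclidean time direction already INFINITE, on the Hilbert space generated from the
vacuum by LOCAL (contractible-loop) gauge-invariant observables — i.e. the zero-electric-flux sector: torelon states, whose energies
vanish to all orders in the coupling, are excluded by construction (ROUTE-P1.md §14.3).  Time → ∞ first is what gives a per-volume
statement spectral content — contrast `T4InfraredHorizon.clusteringPerVolume_of_bounded`.  `gT n` = the running coupling at the scale `side n`
(Bałaban's `F.g` at the step where the block spacing equals `side n`, inside the reach of `T4InfraredHorizon.inInterval_extend`); `lam n = (gT n)^{2/3}`
is Lüscher's expansion parameter.  Nothing is asserted about Yang–Mills: every physical claim is a `Prop`-valued `def`. -/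

section Femto

/-- A complex Hilbert space bundled with transfer data on it.
[cite: GlimmJaffe1987, §6.1 (transfer matrix T = e^{−aH}, vacuum, gap)] -/
structure HTransfer : Type 1 where
  /-- the OS Hilbert space -/
  H : Type
  [i₁ : NormedAddCommGroup H]
  [i₂ : InnerProductSpace ℂ H]
  [i₃ : CompleteSpace H]
  /-- transfer matrix + vacuum (tree structure) -/
  D : TransferData H

/-- The Hilbert-space structure carried by `HTransfer`. [folklore] -/
instance (X : HTransfer) : NormedAddCommGroup X.H := X.i₁

/-- The inner-product structure carried by `HTransfer`. [folklore] -/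
instance (X : HTransfer) : InnerProductSpace ℂ X.H := X.i₂

/-- Completeness carried by `HTransfer`. [folklore] -/
instance (X : HTransfer) : CompleteSpace X.H := X.i₃

/-- THE CARRIER of R2b′ (see the section docstring).
[cite: Luscher1983, §1] [cite: Vanbaal2001, §4 (femto universe: E(ℓ) = ε₁λ/ℓ + O(λ²/ℓ), λ = g(ℓ)^{2/3})] [cite: GlimmJaffe1987, §6.1 (transfer matrix T = e^{−aH}, vacuum, gap)] -/
structure FemtoFamily : Type 1 where
  /-- `X j n`: transfer data at spacing index `j` on the spatial torus of index `n`, time direction infinite, zero-flux sector -/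
  X : ℕ → ℕ → HTransfer
  /-- lattice spacings `a j → 0` -/
  a : ℕ → ℝ
  a_pos : ∀ j, 0 < a j
  /-- physical spatial sides -/
  side : ℕ → ℝ
  side_pos : ∀ n, 0 < side n
  /-- running coupling at the scale `side n` -/
  gT : ℕ → ℝ
  gT_pos : ∀ n, 0 < gT n

/-- Monotonicity of the tree's `HasMassGap` in the rate.
[cite: GlimmJaffe1987, §6.1 (transfer matrix T = e^{−aH}, vacuum, gap)] -/
theorem hasMassGap_mono {X : HTransfer} {m m' : ℝ} (h : X.D.HasMassGap m) (hm' : 0 < m') (hle : m' ≤ m) :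
    X.D.HasMassGap m' :=
  ⟨hm', h.2.trans (Real.exp_le_exp.mpr (neg_le_neg hle))⟩

namespace FemtoFamily

variable (Φ : FemtoFamily)

/-- Lüscher's expansion parameter `λ = g^{2/3}` at the torus scale.
[cite: Luscher1983, §1] [cite: Vanbaal2001, §4 (femto universe: E(ℓ) = ε₁λ/ℓ + O(λ²/ℓ), λ = g(ℓ)^{2/3})] -/
noncomputable def lam (n : ℕ) : ℝ := Φ.gT n ^ (2 / 3 : ℝ)

/-- Lüscher's parameter is positive. [cite: Vanbaal2001, §4] -/
theorem lam_pos (n : ℕ) : 0 < Φ.lam n := Real.rpow_pos_of_pos (Φ.gT_pos n) _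

/-- `λ ≤ γ^{2/3}` when the coupling is `≤ γ`. [cite: Vanbaal2001, §4] -/
theorem lam_le {n : ℕ} {γ : ℝ} (h : Φ.gT n ≤ γ) : Φ.lam n ≤ γ ^ (2 / 3 : ℝ) :=
  Real.rpow_le_rpow (Φ.gT_pos n).le h (by norm_num)

/-- `GapRate Φ S r`: on every torus `n ∈ S`, for all fine enough spacings, the transfer matrix has a mass gap `≥ a_j · r n` per
lattice time step, i.e. a PHYSICAL gap `≥ r n` — uniform in the (infinite) time extent by construction of `HasMassGap`.
[cite: GlimmJaffe1987, §6.1 (transfer matrix T = e^{−aH}, vacuum, gap)] [cite: JaffeWittenClay2006, §6.5 pp.11–12 («a mass gap that is uniform in the volume»)] -/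
def GapRate (S : Set ℕ) (r : ℕ → ℝ) : Prop :=
  ∀ n ∈ S, ∀ᶠ j in atTop, (Φ.X j n).D.HasMassGap (Φ.a j * r n)

/-- R2c-currency at the transfer level: ONE physical rate `Δ > 0` on every torus of `S` (cf. the tree's `HasLatticeMassGap`,
`YangMillsOS.lean`, uniform in the volume).
[cite: JaffeWittenClay2006, §6.5 pp.11–12 («a mass gap that is uniform in the volume»)] -/
def UniformGap (S : Set ℕ) (Δ : ℝ) : Prop := 0 < Δ ∧ Φ.GapRate S fun _ => Δ

/-- Lüscher's femto rate `λ(ε₁ − Cλ)/ℓ = (ε₁ g^{2/3} − C g^{4/3})/ℓ`.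
[cite: Luscher1983, §1] [cite: Vanbaal2001, §4 (femto universe: E(ℓ) = ε₁λ/ℓ + O(λ²/ℓ), λ = g(ℓ)^{2/3})] -/
noncomputable def femtoRate (ε₁ C : ℝ) (n : ℕ) : ℝ := Φ.lam n * (ε₁ - C * Φ.lam n) / Φ.side n

/-- **R2b′ — THE FEMTO-UNIVERSE GAP (typed rung).**  On every torus of the femto reach `S`, eventually in the spacing, the physical
gap of the zero-flux sector is at least `(ε₁ g(ℓ)^{2/3} − C g(ℓ)^{4/3})/ℓ`: a DYNAMICAL (the free zero mode has none:
`trivialHT_not_hasMassGap`), VOLUME-DEPENDENT, NON-UNIFORM lower bound.  `ε₁` is meant to be `luscherEps1` (§3, tree fact `LuscherSimonGap`); `C` absorbs the first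
correction (the one-loop potential along the vacuum valley, relative order `λ`).
[cite: Luscher1983, §1] [cite: Vanbaal2001, §4 (femto universe: E(ℓ) = ε₁λ/ℓ + O(λ²/ℓ), λ = g(ℓ)^{2/3})] [cite: JaffeWittenClay2006, §6.5 pp.11–12 («a mass gap that is uniform in the volume»)] -/
def FemtoGap (S : Set ℕ) (ε₁ C : ℝ) : Prop := Φ.GapRate S (Φ.femtoRate ε₁ C)

/-- The femto reach: tori where the coupling is inside Bałaban's interval `(0, γ]` AND Lüscher's parameter is small, `C·λ < ε₁`.
[cite: Balaban1987RG1, Thm 1 p.256 (0 < g_k ≤ γ)] [cite: Vanbaal2001, §4] -/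
def femtoReach (γ ε₁ C : ℝ) : Set ℕ := {n | Φ.gT n ≤ γ ∧ C * Φ.lam n < ε₁}

/-- The femto rate is positive iff the correction is below the leading term, `C·λ < ε₁`. [cite: Vanbaal2001, §4] -/
theorem femtoRate_pos_iff {ε₁ C : ℝ} {n : ℕ} : 0 < Φ.femtoRate ε₁ C n ↔ C * Φ.lam n < ε₁ := by
  unfold femtoRate
  rw [div_pos_iff_of_pos_right (Φ.side_pos n), mul_pos_iff_of_pos_left (Φ.lam_pos n), sub_pos]

/-- On the femto reach the femto rate is positive. [cite: Vanbaal2001, §4] -/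
theorem femtoRate_pos_of_mem {γ ε₁ C : ℝ} {n : ℕ} (h : n ∈ Φ.femtoReach γ ε₁ C) : 0 < Φ.femtoRate ε₁ C n :=
  Φ.femtoRate_pos_iff.mpr h.2

/-- `GapRate` is monotone in the rate. [cite: GlimmJaffe1987, §6.1 (transfer matrix T = e^{−aH}, vacuum, gap)] -/
theorem GapRate.mono {Φ : FemtoFamily} {S : Set ℕ} {r r' : ℕ → ℝ} (h : Φ.GapRate S r) (hpos : ∀ n ∈ S, 0 < r' n)
    (hle : ∀ n ∈ S, r' n ≤ r n) : Φ.GapRate S r' := fun n hn =>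
  (h n hn).mono fun j hj =>
    hasMassGap_mono hj (mul_pos (Φ.a_pos j) (hpos n hn)) (mul_le_mul_of_nonneg_left (hle n hn) (Φ.a_pos j).le)

/-- `GapRate` restricts to subfamilies of tori.
[cite: GlimmJaffe1987, §6.1 (transfer matrix T = e^{−aH}, vacuum, gap)] -/
theorem GapRate.subset {Φ : FemtoFamily} {S S' : Set ℕ} {r : ℕ → ℝ} (h : Φ.GapRate S r) (hS : S' ⊆ S) : Φ.GapRate S' r :=
  fun n hn => h n (hS hn)

/-- **THE TYPED DIFFERENCE R2b′ ↝ R2c.**  A per-volume rate gives the uniform gap EXACTLY when it is bounded below by a positive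
constant on `S` — the only passage by monotonicity.
[cite: JaffeWittenClay2006, §6.5 pp.11–12 («a mass gap that is uniform in the volume»)] -/
theorem uniformGap_of_inf {S : Set ℕ} {r : ℕ → ℝ} {Δ : ℝ} (h : Φ.GapRate S r) (hΔ : 0 < Δ) (hinf : ∀ n ∈ S, Δ ≤ r n) :
    Φ.UniformGap S Δ :=
  ⟨hΔ, h.mono (fun _ _ => hΔ) hinf⟩

/-- A uniform gap gives every smaller positive per-volume rate.
[cite: JaffeWittenClay2006, §6.5 pp.11–12 («a mass gap that is uniform in the volume»)] -/
theorem UniformGap.gapRate {Φ : FemtoFamily} {S : Set ℕ} {Δ : ℝ} (h : Φ.UniformGap S Δ) {r : ℕ → ℝ}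
    (hpos : ∀ n ∈ S, 0 < r n) (hle : ∀ n ∈ S, r n ≤ Δ) : Φ.GapRate S r :=
  h.2.mono hpos hle

/-- … and the femto rate is NOT bounded below on an unbounded family of tori: inside the reach (`g(ℓ) ≤ γ`) it is
`≤ γ^{2/3}(|ε₁|+|C|γ^{2/3})/ℓ → 0` as `ℓ → ∞`.  So R2b′ ⇏ R2c by monotonicity; the missing input is a VOLUME-INDEPENDENT lower bound
(confinement-scale physics, README R2c), invisible to the femto expansion.
[cite: Vanbaal2001, §4] [cite: JaffeWittenClay2006, §6.5 pp.11–12 («a mass gap that is uniform in the volume»)] -/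
theorem femtoRate_tendsto_zero {γ ε₁ C : ℝ} (hg : ∀ n, Φ.gT n ≤ γ) (hside : Tendsto Φ.side atTop atTop) :
    Tendsto (Φ.femtoRate ε₁ C) atTop (𝓝 0) := by
  have hγ : 0 < γ := (Φ.gT_pos 0).trans_le (hg 0)
  set L := γ ^ (2 / 3 : ℝ) with hL
  have hL0 : 0 ≤ L := Real.rpow_nonneg hγ.le _
  have hlam : ∀ n, Φ.lam n ≤ L := fun n => Φ.lam_le (hg n)
  have hbound : ∀ n, |Φ.femtoRate ε₁ C n| ≤ L * (|ε₁| + |C| * L) / Φ.side n := by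
    intro n
    have hl0 := (Φ.lam_pos n).le
    unfold femtoRate
    rw [abs_div, abs_of_pos (Φ.side_pos n), abs_mul, abs_of_nonneg hl0]
    refine div_le_div_of_nonneg_right ?_ (Φ.side_pos n).le
    have h1 : |ε₁ - C * Φ.lam n| ≤ |ε₁| + |C| * L := by
      calc |ε₁ - C * Φ.lam n| ≤ |ε₁| + |C * Φ.lam n| := abs_sub _ _
        _ = |ε₁| + |C| * Φ.lam n := by rw [abs_mul, abs_of_nonneg hl0]
        _ ≤ |ε₁| + |C| * L := by gcongr; exact hlam n
    exact mul_le_mul (hlam n) h1 (abs_nonneg _) hL0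
  have hmaj : Tendsto (fun n => L * (|ε₁| + |C| * L) / Φ.side n) atTop (𝓝 0) := hside.const_div_atTop _
  exact squeeze_zero_norm (fun n => by simpa [Real.norm_eq_abs] using hbound n) hmaj

/-- Consequently no positive constant sits below the femto rate on all of an unbounded reach.
[cite: Vanbaal2001, §4] [cite: JaffeWittenClay2006, §6.5 pp.11–12 («a mass gap that is uniform in the volume»)] -/
theorem not_inf_pos_femtoRate {γ ε₁ C Δ : ℝ} (hg : ∀ n, Φ.gT n ≤ γ) (hside : Tendsto Φ.side atTop atTop) (hΔ : 0 < Δ) :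
    ¬ ∀ n, Δ ≤ Φ.femtoRate ε₁ C n := by
  intro h
  have hev := (Φ.femtoRate_tendsto_zero (ε₁ := ε₁) (C := C) hg hside).eventually (gt_mem_nhds hΔ)
  obtain ⟨n, hn⟩ := hev.exists
  exact absurd (h n) (not_le.mpr hn)

/-- N34 [ZM] — LÜSCHER'S ZERO-MODE ASYMPTOTICS as a typed statement (NODE-O++; the two-sided form).  `E j n` = a physical gap of the
transfer data (any number with `HasMassGap (a_j · E j n)`), and `|E·ℓ − ε₁ λ| ≤ C λ²` on the reach, eventually in the spacing.
[cite: Luscher1983, §1] [cite: Vanbaal2001, §4 (femto universe: E(ℓ) = ε₁λ/ℓ + O(λ²/ℓ), λ = g(ℓ)^{2/3})] [cite: LuscherMunster1984, (weak-coupling expansion of the low-lying energy values)] -/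
def ZeroModeAsymptotics (S : Set ℕ) (E : ℕ → ℕ → ℝ) (ε₁ C : ℝ) : Prop :=
  ∀ n ∈ S, ∀ᶠ j in atTop, (Φ.X j n).D.HasMassGap (Φ.a j * E j n) ∧
    |E j n * Φ.side n - ε₁ * Φ.lam n| ≤ C * Φ.lam n ^ 2

/-- [ZM] ⇒ R2b′ on the part of `S` where the femto rate is positive (pure arithmetic + monotonicity).
[cite: Vanbaal2001, §4] -/
theorem femtoGap_of_asymptotics {S : Set ℕ} {E : ℕ → ℕ → ℝ} {ε₁ C : ℝ} (h : Φ.ZeroModeAsymptotics S E ε₁ C)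
    (hpos : ∀ n ∈ S, C * Φ.lam n < ε₁) : Φ.FemtoGap S ε₁ C := by
  intro n hn
  refine (h n hn).mono fun j hj => ?_
  obtain ⟨hgap, hasy⟩ := hj
  have hrate : 0 < Φ.femtoRate ε₁ C n := Φ.femtoRate_pos_iff.mpr (hpos n hn)
  refine hasMassGap_mono hgap (mul_pos (Φ.a_pos j) hrate) (mul_le_mul_of_nonneg_left ?_ (Φ.a_pos j).le)
  have hℓ := Φ.side_pos n
  have hlow : ε₁ * Φ.lam n - C * Φ.lam n ^ 2 ≤ E j n * Φ.side n := by
    have := (abs_le.mp hasy).1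
    linarith
  unfold femtoRate
  rw [div_le_iff₀ hℓ]
  nlinarith [hlow]

/-- On the femto reach the hypothesis `hpos` of `femtoGap_of_asymptotics` holds by definition.
[cite: Vanbaal2001, §4] -/
theorem femtoGap_of_asymptotics_reach {γ ε₁ C : ℝ} {E : ℕ → ℕ → ℝ}
    (h : Φ.ZeroModeAsymptotics (Φ.femtoReach γ ε₁ C) E ε₁ C) : Φ.FemtoGap (Φ.femtoReach γ ε₁ C) ε₁ C :=
  Φ.femtoGap_of_asymptotics h fun _ hn => hn.2

/-- `GapRate` read as TIME-clustering (the tree's `HasMassGap.norm_inner_pow_apply_sub_le`): on each torus of `S`, eventually in the spacing,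
ALL matrix elements of `Tᵗ` cluster at the physical rate `r n` for EVERY `t : ℕ` — the time separation is unbounded, which is exactly what a finite
symmetric torus cannot offer (contrast `T4InfraredHorizon.clusteringPerVolume_of_bounded`: there `d ≤ diam n`).
[cite: GlimmJaffe1987, §6.1 Theorem 6.1.3] -/
theorem GapRate.clustering {Φ : FemtoFamily} {S : Set ℕ} {r : ℕ → ℝ} (h : Φ.GapRate S r) {n : ℕ} (hn : n ∈ S) :
    ∀ᶠ j in atTop, ∀ (u v : (Φ.X j n).H) (t : ℕ),
      ‖inner ℂ u (((Φ.X j n).D.T ^ t) v) - inner ℂ u (Φ.X j n).D.vacuum * inner ℂ (Φ.X j n).D.vacuum v‖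
        ≤ ‖u‖ * ‖v‖ * Real.exp (-(Φ.a j * r n) * t) :=
  (h n hn).mono fun _ hj u v t => hj.norm_inner_pow_apply_sub_le u v t

/-- **R2c ⇒ R2b′ (cofinitely).**  A uniform gap on `S` gives the femto gap on all large enough tori of `S` where the femto rate is positive — because
the femto rate tends to `0` it eventually drops below any `Δ > 0`.  With `not_inf_pos_femtoRate` this places R2b′ STRICTLY between R2a and R2c.
[cite: JaffeWittenClay2006, §6.5 pp.11–12 («a mass gap that is uniform in the volume»)] [cite: Vanbaal2001, §4] -/
theorem femtoGap_eventually_of_uniformGap {S : Set ℕ} {γ ε₁ C Δ : ℝ} (hU : Φ.UniformGap S Δ) (hg : ∀ n, Φ.gT n ≤ γ)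
    (hside : Tendsto Φ.side atTop atTop) : ∃ N : ℕ, Φ.FemtoGap (S ∩ {n | N ≤ n ∧ C * Φ.lam n < ε₁}) ε₁ C := by
  have hev := (Φ.femtoRate_tendsto_zero (ε₁ := ε₁) (C := C) hg hside).eventually (eventually_le_nhds hU.1)
  obtain ⟨N, hN⟩ := eventually_atTop.mp hev
  refine ⟨N, fun n hn => ?_⟩
  obtain ⟨hnS, hNn, hpos⟩ := hn
  exact (hU.2 n hnS).mono fun j hj =>
    hasMassGap_mono hj (mul_pos (Φ.a_pos j) (Φ.femtoRate_pos_iff.mpr hpos))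
      (mul_le_mul_of_nonneg_left (hN n hNn) (Φ.a_pos j).le)

end FemtoFamily

/-! ## §2 Non-vacuity: the free zero mode.  `T = id` on `ℂ²` (a mode of zero energy orthogonal to the vacuum — the cartoon of a
non-compact free field's constant mode, i.e. of the classically flat valley before the commutator term lifts it) is legitimate transfer
data with NO mass gap.  So `GapRate`/`FemtoGap` have content on each torus separately, unlike per-volume clustering on a finite torus (`T4InfraredHorizon` §3). -/

/-- Transfer data of a free zero mode: `T = id`, `Ω = e₀` on `ℂ²`.
[cite: GlimmJaffe1987, §6.1 (transfer matrix T = e^{−aH}, vacuum, gap)] -/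
noncomputable def trivialTD : TransferData (EuclideanSpace ℂ (Fin 2)) where
  T := ContinuousLinearMap.id ℂ _
  vacuum := EuclideanSpace.single 0 1
  isPositive := ContinuousLinearMap.isPositive_id
  norm_le_one := ContinuousLinearMap.norm_id_le
  map_vacuum := rfl
  norm_vacuum := by simp

/-- The free zero mode has a state orthogonal to the vacuum. [folklore] -/
private theorem trivialTD_orthogonal_ne_bot : (trivialTD.vacuumLine)ᗮ ≠ ⊥ := by
  intro hbot
  have hmem : (EuclideanSpace.single 1 (1 : ℂ) : EuclideanSpace ℂ (Fin 2)) ∈ (trivialTD.vacuumLine)ᗮ := by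
    unfold TransferData.vacuumLine
    rw [Submodule.mem_orthogonal_singleton_iff_inner_right]
    rw [show trivialTD.vacuum = EuclideanSpace.single 0 (1 : ℂ) from rfl, EuclideanSpace.inner_single_left]
    simp
  rw [hbot, Submodule.mem_bot] at hmem
  have := congrArg (fun v : EuclideanSpace ℂ (Fin 2) => v 1) hmem
  simp at this

/-- The free zero mode has gap norm `‖T P_⊥‖ = 1`: no decay.
[cite: GlimmJaffe1987, §6.1 (transfer matrix T = e^{−aH}, vacuum, gap)] -/
theorem trivialTD_gapNorm : trivialTD.gapNorm = 1 := by
  unfold TransferData.gapNorm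
  rw [show trivialTD.T = ContinuousLinearMap.id ℂ _ from rfl, ContinuousLinearMap.id_comp]
  exact Submodule.norm_starProjection _ trivialTD_orthogonal_ne_bot

/-- The free zero mode has NO mass gap. [cite: GlimmJaffe1987, §6.1 (transfer matrix T = e^{−aH}, vacuum, gap)] -/
theorem trivialTD_not_hasMassGap (m : ℝ) (hm : 0 < m) : ¬ trivialTD.HasMassGap m := by
  rintro ⟨-, h⟩
  rw [trivialTD_gapNorm] at h
  have : Real.exp (-m) < 1 := Real.exp_lt_one_iff.mpr (by linarith)
  linarith

/-- … bundled. [cite: GlimmJaffe1987, §6.1 (transfer matrix T = e^{−aH}, vacuum, gap)] -/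
noncomputable def trivialHT : HTransfer := { H := EuclideanSpace ℂ (Fin 2), D := trivialTD }

/-- The bundled free zero mode has no mass gap.
[cite: GlimmJaffe1987, §6.1 (transfer matrix T = e^{−aH}, vacuum, gap)] -/
theorem trivialHT_not_hasMassGap (m : ℝ) (hm : 0 < m) : ¬ trivialHT.D.HasMassGap m :=
  trivialTD_not_hasMassGap m hm

/-- The family all of whose entries are the free zero mode (any spacings, sides, couplings). [folklore] -/
noncomputable def trivialFamily (a side gT : ℕ → ℝ) (ha : ∀ j, 0 < a j) (hs : ∀ n, 0 < side n) (hg : ∀ n, 0 < gT n) :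
    FemtoFamily :=
  ⟨fun _ _ => trivialHT, a, ha, side, hs, gT, hg⟩

/-- … violates `GapRate` for every positive rate on every nonempty `S` (while it has everything R2a asks of a torus state:
existence, positivity of `T`, an invariant vacuum).  So `GapRate` / `FemtoGap` are NOT consequences of R2a-type data.
[cite: GlimmJaffe1987, §6.1 (transfer matrix T = e^{−aH}, vacuum, gap)] [cite: JaffeWittenClay2006, §6.5 pp.11–12 («a mass gap that is uniform in the volume»)] -/
theorem not_gapRate_trivialFamily {a side gT : ℕ → ℝ} (ha : ∀ j, 0 < a j) (hs : ∀ n, 0 < side n) (hg : ∀ n, 0 < gT n)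
    {S : Set ℕ} {r : ℕ → ℝ} {n : ℕ} (hn : n ∈ S) (hr : 0 < r n) :
    ¬ (trivialFamily a side gT ha hs hg).GapRate S r := by
  intro h
  obtain ⟨j, hj⟩ := (h n hn).exists
  exact trivialHT_not_hasMassGap _ (mul_pos (ha j) hr) hj

/-- Vocabulary link with `T4InfraredHorizon` §3: inside the reach (`inInterval_extend` / `irReach_steps`) the coupling at the torus scale lies in Bałaban's
interval, so `gT n ≤ γ` is exactly what the reach delivers for the femto family.
[cite: Balaban1987RG1, Thm 1 p.256 (0 < g_k ≤ γ)] -/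
theorem coupling_le_of_inInterval (F : Flow) {γ : ℝ} {k : ℕ} (h : F.InInterval γ k) : F.g k ≤ γ := (h k le_rfl).2

end Femto

/-! ## §3 The leading constant by name: `ε₁ = luscherEps1` from the Literature fact `LuscherSimonGap` -/

section Luscher

open Literature.Analysis.OperatorTheory.YMMatrixModel

/-- With `ε₁ = luscherEps1` and a correction constant `C > 0`, the femto reach is exactly «coupling inside Bałaban's interval and
Lüscher's parameter below `luscherEps1 / C`».
[cite: SimonB1983DiscreteSpectrum, Cor. 4 p.217] [cite: Vanbaal2001, §4] -/
theorem femtoReach_luscher_iff (Φ : FemtoFamily) {γ C : ℝ} (hC : 0 < C) (n : ℕ) :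
    n ∈ Φ.femtoReach γ luscherEps1 C ↔ Φ.gT n ≤ γ ∧ Φ.lam n < luscherEps1 / C := by
  show Φ.gT n ≤ γ ∧ C * Φ.lam n < luscherEps1 ↔ _
  rw [lt_div_iff₀ hC, mul_comm]

/-- **THE FACT MAKES THE REACH NON-DEGENERATE.**  Granted `LuscherSimonGap` (KNOWN, [SimonB1983DiscreteSpectrum] Cor. 4; a hypothesis here), `0 < luscherEps1`,
so for every correction constant `C` every torus with coupling in the interval and SMALL ENOUGH Lüscher parameter is in the reach —
the threshold `luscherEps1 / C` is positive (for `C ≤ 0` there is no constraint at all).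
[cite: SimonB1983DiscreteSpectrum, Cor. 4 p.217] [cite: Vanbaal2001, §4] -/
theorem mem_femtoReach_luscher (hLS : LuscherSimonGap) (Φ : FemtoFamily) {γ C : ℝ} {n : ℕ} (hg : Φ.gT n ≤ γ)
    (hlam : C * Φ.lam n < luscherEps1) : n ∈ Φ.femtoReach γ luscherEps1 C ∧ 0 < luscherEps1 :=
  ⟨⟨hg, hlam⟩, hLS.2⟩

/-- Without a positive correction constant the femto reach is just Bałaban's interval.
[cite: SimonB1983DiscreteSpectrum, Cor. 4 p.217] -/
theorem femtoReach_luscher_of_nonpos (hLS : LuscherSimonGap) (Φ : FemtoFamily) {γ C : ℝ} (hC : C ≤ 0) :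
    Φ.femtoReach γ luscherEps1 C = {n | Φ.gT n ≤ γ} := by
  ext n
  refine ⟨fun h => h.1, fun h => ⟨h, ?_⟩⟩
  exact lt_of_le_of_lt (mul_nonpos_of_nonpos_of_nonneg hC (Φ.lam_pos n).le) hLS.2

/-- **N34 at `ε₁ = luscherEps1` ⇒ R2b′ on the whole femto reach** (= `femtoGap_of_asymptotics_reach`, the constant named).
[cite: Luscher1983, §1] [cite: SimonB1983DiscreteSpectrum, Cor. 4 p.217] -/
theorem femtoGap_luscher_of_asymptotics (Φ : FemtoFamily) {γ C : ℝ} {E : ℕ → ℕ → ℝ}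
    (h : Φ.ZeroModeAsymptotics (Φ.femtoReach γ luscherEps1 C) E luscherEps1 C) :
    Φ.FemtoGap (Φ.femtoReach γ luscherEps1 C) luscherEps1 C :=
  Φ.femtoGap_of_asymptotics_reach h

end Luscher

/-! ## §4 The precision budget of R2b′'s last step — even analytic perturbations of the zero-mode problem are
QUADRATICALLY small with constants read off an ANALYTICITY RADIUS; N35 `BackgroundBudget` = the printed k-uniform bounds read on the
constant-mode slice, typed as a hypothesis shape; the Kaluza–Klein separation of the non-constant modes

DICTIONARY (ROUTE-P1.md §17).  Let `N` be the side of the spatial torus in lattice units of the scale at which the nine constant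
modes `θ = (θ_i^a)` are split off (a FIXED geometric number; physical side `ℓ`), `U_θ` the constant configuration `exp(iθ_i/N)` on the
direction-`i` bonds (holonomy `exp iθ_i`; for non-commuting `θ` the plaquettes are `1 + O(|θ|²/N²)`), and — granted a carrier — let
`W k : ℂ → E` be a complex slice `t ↦ 𝒲_k(t·u)` (`|u| = 1`) of the `θ`-dependent part of the final effective action of one RG run with
`k` steps, per unit Euclidean time.  PRINT (B12 = [Bałaban, CMP 109 (1987)]): after the Ward–Takahashi extraction of the marginal term
`β_j A^η` the effective action is `−g_k⁻² A^η(U_k) + Σ_j Σ_X V^{(j)}(X, U_k) + const` (0.28) with IRRELEVANT localised terms,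
`|V^{(j)}(X, U_k)| ≤ O(1)(L^jη)^{4+α} e^{−κ d_j(X)}`, `α > 0` (0.29), analytic «on their domains of analyticity» (p. 281), summing to
`O(1)(1 − L^{−α})⁻¹ M⁻⁴ |T_η|` (0.30): «a uniform bound … the only dependence on k is through the volume» (p. 258), «uniform in the lattice
spacing ε. This is the essence of the ultraviolet stability» (p. 259); the domains (1.11)–(1.16) (p. 262) are `G^c`-gauge orbits of
`{U′·U : |∂U − 1| < α₀ξ², U′ = exp iξA′, A′ COMPLEX, |A′|, |∇A′| < α₁}` with «positive, absolute constants α₀, α₁ (i.e., constants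
independent of X and j)» (p. 263); (1.19): invariance under all `G^c`-valued gauge transformations; p. 263: invariance under the
Euclidean lattice symmetries.  CONSEQUENCES read on the slice: (i) RADIUS — `U_θ` with COMPLEX `θ`, `|θ| < ρ₀N`, `ρ₀ = c·min(α₁, √α₀)`
absolute, lies in every domain (`U = 1`, `A′ = θ/N` rescaled), so `ρ = ρ₀N`, uniformly in `k` and in the time extent; (ii) BOUND — by
(0.30) per unit time `C = O(1)M⁻⁴N³`; (iii) NO LINEAR TERM — cubic rotations act on `θ` without invariant vectors (or: the reflection
`θ ↦ −θ` composed with `X ↦ −X` preserves `Σ_X`), so `deriv (W k) 0 = 0` (`deriv_zero_of_even`).  By contrast the small-field windows of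
the characteristic functions SHRINK with the coupling (B14 = [CMP 119 (1988)] p. 246: «ε₀ = g₀p₀(g₀), p₀(g₀) = A₀(log g₀⁻²)^{p₀}»): the
budget consumes the analyticity radius, never the probabilistic window (and Lüscher's wave functions, `|θ| ~ λ|x|`, plaquettes
`1 + O(λ²/N²)`, sit deep inside both).  The lemma below (`norm_sub_apply_zero_le_of_deriv_eq_zero`, from the tree's order-n Schwarz lemma
`B11SchwarzRemainder.norm_sub_leadCoeff_le`) turns (i)–(iii) into `‖W(t) − W(0)‖ ≤ 2C(|t|/ρ)²`: at Lüscher's spread `t = λx`,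
`λ = g(ℓ)^{2/3}`, the remainders move the zero-mode levels by `≤ λ²·2Cx²/ρ²` per unit time, i.e. by RELATIVE `O(λ)·O(1)N²/(M⁴ρ₀²ε₁)`
against the `O(λ)` leading spacing (`budget_ratio`) — an astronomical but ABSOLUTE constant (the true coefficient is Lüscher's
`γ₁ = −0.30104661`, van Baal p. 7), which is all `ZeroModeAsymptotics` (`|E·ℓ − ε₁λ| ≤ Cλ²`, SOME `C`) asks.  `BackgroundBudget` (node
N35) types exactly the shape (i)–(iii) as a HYPOTHESIS on an abstract carrier `W : ℕ → ℂ → E`, because the tree has no carrier for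
`𝒲_k` (it needs NODE O's objects: the expectation / transfer-matrix form of (0.1), deferred in B16 p. 356, on an asymmetric torus) —
what remains of N35 is PACKAGING of printed bounds, not a new estimate; the large-field contributions (smaller than any power of
`g_k`, B14/B16) are outside the analytic representation and belong to the same packaging.  Nothing here constructs `𝒲_k`. -/

section Budget

open Metric Set
open Literature.MathematicalPhysics.QuantumFieldTheory.Balaban1983to89.B11SchwarzRemainder

variable {E : Type*} [NormedAddCommGroup E] [NormedSpace ℂ E] [CompleteSpace E]

omit [CompleteSpace E] in
/-- the derivative of an even function at `0` vanishes (lattice parity ⇒ no linear term in the holonomy).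
[folklore] -/
private theorem deriv_zero_of_even {f : ℂ → E} (heven : ∀ t, f (-t) = f t) : deriv f 0 = 0 := by
  have h1 : deriv (fun t => f (-t)) 0 = -deriv f (-0) := deriv_comp_neg f 0
  have h2 : (fun t => f (-t)) = f := funext heven
  rw [h2, neg_zero] at h1
  have h3 : (2 : ℝ) • deriv f 0 = 0 := by
    rw [two_smul]
    exact (congrArg (deriv f 0 + ·) h1).trans (add_neg_cancel _)
  exact (smul_eq_zero.mp h3).resolve_left two_ne_zero

/-- **SCHWARZ BUDGET, NO LINEAR TERM** (PROVED, one-variable complex analysis): `f` analytic on `|t| < r`, `‖f‖ ≤ M` there,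
`f′(0) = 0` ⟹ `‖f(t) − f(0)‖ ≤ 2M(|t|/r)²`.  (Order-2 Schwarz lemma for `f − f(0)`: order 1 from the subtraction, the linear
Taylor coefficient is `f′(0) = 0`, then the tree's `norm_sub_leadCoeff_le` with `A = 0`.)  The linear term vanishes along every
slice of the constant-mode effective action by lattice-rotation covariance (no invariant vector) or by reflection (evenness,
`deriv_zero_of_even`).
[cite: Balaban1985Variational, (55)-(56) p.286 (Schwarz-lemma remainder bounds)] [cite: Balaban1987RG1, (1.11)–(1.16) pp.262–263 (analyticity domains)] -/
theorem norm_sub_apply_zero_le_of_deriv_eq_zero {r M : ℝ} {f : ℂ → E} (hd : DifferentiableOn ℂ f (ball 0 r))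
    (hM : ∀ t ∈ ball (0 : ℂ) r, ‖f t‖ ≤ M) (h1 : deriv f 0 = 0) {t : ℂ} (ht : t ∈ ball (0 : ℂ) r) :
    ‖f t - f 0‖ ≤ 2 * M * (‖t‖ / r) ^ 2 := by
  have hr : 0 < r := lt_of_le_of_lt (norm_nonneg t) (mem_ball_zero_iff.mp ht)
  have hgd : DifferentiableOn ℂ (fun s => f s - f 0) (ball 0 r) := hd.sub_const (f 0)
  have h0M : ‖f 0‖ ≤ M := hM 0 (mem_ball_self hr)
  have hgM : ∀ s ∈ ball (0 : ℂ) r, ‖(fun s => f s - f 0) s‖ ≤ 2 * M := fun s hs =>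
    (norm_sub_le (f s) (f 0)).trans (by linarith [hM s hs])
  have hg0 : (fun s => f s - f 0) 0 = 0 := sub_self _
  have hgO : OrderGe (fun s => f s - f 0) 1 := by
    refine OrderGe.of_eq_pow_smul (g := dslope (fun s => f s - f 0) 0) ?_ ?_
    · exact continuousAt_dslope_same.mpr (hgd.differentiableAt (ball_mem_nhds (0 : ℂ) hr))
    · intro s
      rw [pow_one, ← sub_smul_dslope_of_zero (f := fun s => f s - f 0) (a := 0) hg0 s, sub_zero]
  have hlead : leadCoeff (fun s => f s - f 0) 1 = 0 := by
    rw [leadCoeff_one, deriv_sub_const, h1]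
  have h := norm_sub_leadCoeff_le hgd hgM hgO (A := 0) (by rw [hlead, norm_zero]) ht
  rw [hlead, smul_zero, sub_zero] at h
  have h2 : (2 * M + 0 * r ^ 1) * (‖t‖ / r) ^ (1 + 1) = 2 * M * (‖t‖ / r) ^ 2 := by ring
  rw [h2] at h
  exact h

/-- the EVEN case (lattice reflection invariance, B12 p. 263: the actions are invariant under the Euclidean transformations
of the lattice).
[cite: Balaban1985Variational, (55)-(56) p.286 (Schwarz-lemma remainder bounds)] [cite: Balaban1987RG1, (1.11)–(1.16) pp.262–263 (analyticity domains)] [cite: Balaban1987RG1, p.263 (invariance under the lattice symmetries)] -/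
theorem norm_sub_apply_zero_le_of_even {r M : ℝ} {f : ℂ → E} (hd : DifferentiableOn ℂ f (ball 0 r))
    (hM : ∀ t ∈ ball (0 : ℂ) r, ‖f t‖ ≤ M) (heven : ∀ t, f (-t) = f t) {t : ℂ} (ht : t ∈ ball (0 : ℂ) r) :
    ‖f t - f 0‖ ≤ 2 * M * (‖t‖ / r) ^ 2 :=
  norm_sub_apply_zero_le_of_deriv_eq_zero hd hM (deriv_zero_of_even heven) ht

/-- the budget ALONG LÜSCHER'S SPREAD `t = λ·x` (real): `‖f(λx) − f(0)‖ ≤ λ² · (2M x²/r²)` whenever `|λx| < r`.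
[cite: Balaban1985Variational, (55)-(56) p.286 (Schwarz-lemma remainder bounds)] [cite: Balaban1987RG1, (1.11)–(1.16) pp.262–263 (analyticity domains)] [cite: Vanbaal2001, §4] -/
theorem norm_sub_apply_zero_le_real {r M : ℝ} {f : ℂ → E} (hd : DifferentiableOn ℂ f (ball 0 r))
    (hM : ∀ t ∈ ball (0 : ℂ) r, ‖f t‖ ≤ M) (h1 : deriv f 0 = 0) {lam x : ℝ} (hlx : |lam * x| < r) :
    ‖f ((lam * x : ℝ) : ℂ) - f 0‖ ≤ lam ^ 2 * (2 * M * x ^ 2 / r ^ 2) := by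
  have ht : ((lam * x : ℝ) : ℂ) ∈ ball (0 : ℂ) r := by
    rw [mem_ball_zero_iff, Complex.norm_real, Real.norm_eq_abs]; exact hlx
  have h := norm_sub_apply_zero_le_of_deriv_eq_zero hd hM h1 ht
  rw [Complex.norm_real, Real.norm_eq_abs, div_pow, sq_abs] at h
  calc ‖f ((lam * x : ℝ) : ℂ) - f 0‖ ≤ 2 * M * ((lam * x) ^ 2 / r ^ 2) := h
    _ = lam ^ 2 * (2 * M * x ^ 2 / r ^ 2) := by ring

/-- RELATIVE SIZE: a shift `≤ λ²K` against a leading spacing `ε₁λ` (`ε₁ > 0`, `λ > 0`) is the fraction `λ·(K/ε₁)` of it —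
`O(λ) = O(g^{2/3})` relative, with an ABSOLUTE constant iff `K = 2C x²/ρ²` is (i.e. iff `C`, `ρ` are k-uniform: N35).
[cite: Vanbaal2001, §4] -/
theorem budget_ratio {lam K ε₁ : ℝ} (hlam : 0 < lam) (hε : 0 < ε₁) :
    lam ^ 2 * K / (ε₁ * lam) = lam * (K / ε₁) := by
  field_simp

/-- **N35 [BKG] `BackgroundBudget`** — the k-UNIFORM ANALYTICITY BUDGET of the constant-mode effective action, typed as a
hypothesis SHAPE over an abstract carrier (the carrier objects are NODE O's).  Reading: along every slice, the constant-mode-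
dependent part `W k` of the scale-`k` effective action (per unit time) is analytic on ONE disc `|t| < ρ`, bounded there by ONE
constant `C`, with no linear term — `ρ`, `C` INDEPENDENT of the scale index `k` (and of the time extent).  STATUS (ROUTE-P1.md
§17.4): IN PRINT modulo the carrier — B12 (0.28)–(0.30) p. 258 (after the Ward–Takahashi extraction of the marginal term `βA_η`
the remaining terms obey `|V^{(j)}(X, U_k)| ≤ O(1)(L^jη)^{4+α}e^{−κd_j(X)}`, `α > 0`, and their sum is bounded uniformly in `k`:
«the only dependence on k is through the volume |T_η|»), on the absolute analyticity domains (1.11)–(1.16) p. 262, with the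
linear term killed by the lattice symmetries p. 263; for the flat valley with the exponentially small constant of (1.18)–(1.19).
It is Lüscher's one-loop `V_eff` (`γ₁Σr_i²`, van Baal hep-ph/0008206 p. 7: `γ₁ = −0.30104661`) made non-perturbative inside the
construction.
[cite: Balaban1987RG1, (0.28)–(0.30) pp.258–259, (1.11)–(1.16) pp.262–263 and p.263 (lattice symmetries); hypothesis shape, never asserted] -/
def BackgroundBudget (W : ℕ → ℂ → E) (ρ C : ℝ) : Prop :=
  0 < ρ ∧ 0 ≤ C ∧ ∀ k, DifferentiableOn ℂ (W k) (ball 0 ρ) ∧ (∀ t ∈ ball (0 : ℂ) ρ, ‖W k t‖ ≤ C) ∧ deriv (W k) 0 = 0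

omit [CompleteSpace E] in
/-- the even (reflection-symmetric) form implies the hypothesis.
[cite: Balaban1987RG1, (0.28)–(0.30) pp.258–259, (1.11)–(1.16) pp.262–263 and p.263 (lattice symmetries); hypothesis shape, never asserted] -/
theorem BackgroundBudget.of_even {W : ℕ → ℂ → E} {ρ C : ℝ} (hρ : 0 < ρ) (hC : 0 ≤ C)
    (h : ∀ k, DifferentiableOn ℂ (W k) (ball 0 ρ) ∧ (∀ t ∈ ball (0 : ℂ) ρ, ‖W k t‖ ≤ C) ∧ ∀ t, W k (-t) = W k t) :
    BackgroundBudget W ρ C :=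
  ⟨hρ, hC, fun k => ⟨(h k).1, (h k).2.1, deriv_zero_of_even (h k).2.2⟩⟩

/-- N35 ⇒ the k-UNIFORM quadratic budget (PROVED from the Schwarz budget).
[cite: Balaban1987RG1, (0.28)–(0.30) pp.258–259, (1.11)–(1.16) pp.262–263 and p.263 (lattice symmetries); hypothesis shape, never asserted] [cite: Balaban1985Variational, (55)-(56) p.286] -/
theorem BackgroundBudget.quadratic {W : ℕ → ℂ → E} {ρ C : ℝ} (h : BackgroundBudget W ρ C) (k : ℕ) {t : ℂ}
    (ht : t ∈ ball (0 : ℂ) ρ) : ‖W k t - W k 0‖ ≤ 2 * C * (‖t‖ / ρ) ^ 2 :=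
  norm_sub_apply_zero_le_of_deriv_eq_zero (h.2.2 k).1 (h.2.2 k).2.1 (h.2.2 k).2.2 ht

/-- N35 ⇒ along Lüscher's spread, uniformly in `k`: `‖W_k(λx) − W_k(0)‖ ≤ λ²·(2C x²/ρ²)` for `|λx| < ρ`.
[cite: Balaban1987RG1, (0.28)–(0.30) pp.258–259, (1.11)–(1.16) pp.262–263 and p.263 (lattice symmetries); hypothesis shape, never asserted] [cite: Vanbaal2001, §4] -/
theorem BackgroundBudget.spread {W : ℕ → ℂ → E} {ρ C : ℝ} (h : BackgroundBudget W ρ C) (k : ℕ) {lam x : ℝ}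
    (hlx : |lam * x| < ρ) : ‖W k ((lam * x : ℝ) : ℂ) - W k 0‖ ≤ lam ^ 2 * (2 * C * x ^ 2 / ρ ^ 2) :=
  norm_sub_apply_zero_le_real (h.2.2 k).1 (h.2.2 k).2.1 (h.2.2 k).2.2 hlx

omit [CompleteSpace E] in
/-- NON-VACUITY of the hypothesis shape: `k`-indexed constants satisfy it (so does any even polynomial on a disc).
[cite: Balaban1987RG1, (0.28)–(0.30) pp.258–259, (1.11)–(1.16) pp.262–263 and p.263 (lattice symmetries); hypothesis shape, never asserted] -/
theorem backgroundBudget_const (c : ℕ → E) {ρ C : ℝ} (hρ : 0 < ρ) (hC : ∀ k, ‖c k‖ ≤ C) :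
    BackgroundBudget (fun k _ => c k) ρ C :=
  ⟨hρ, (norm_nonneg _).trans (hC 0), fun k =>
    ⟨differentiableOn_const (c k), fun _ _ => hC k, by simp⟩⟩

omit [CompleteSpace E] in
/-- … and it BITES: the odd function `t ↦ t • v` (`v ≠ 0`) is analytic and bounded on the unit disc but violates the
no-linear-term clause — the clause the lattice symmetries supply and without which a perturbation of spread `λ` would shift
levels by `O(λ)`, i.e. by relative `O(1)`.
[cite: Balaban1987RG1, (0.28)–(0.30) pp.258–259, (1.11)–(1.16) pp.262–263 and p.263 (lattice symmetries); hypothesis shape, never asserted] -/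
theorem not_backgroundBudget_linear (v : E) (hv : v ≠ 0) (C : ℝ) :
    ¬ BackgroundBudget (fun _ t => t • v) 1 C := by
  rintro ⟨-, -, h⟩
  have h1 : deriv (fun t : ℂ => t • v) 0 = 0 := (h 0).2.2
  have h2 : deriv (fun t : ℂ => t • v) 0 = v := by
    have := ((hasDerivAt_id (0 : ℂ)).smul_const v).deriv
    simpa using this
  exact hv (h2.symm.trans h1)

/-- **KALUZA–KLEIN MASS of the non-constant modes** (kinematics, NOT a gap of the theory): on a periodic lattice of side
`N ≥ 2` the lowest non-zero lattice momentum is `|p̂| = 2 sin(π/N)` per lattice unit, i.e. `2N·sin(π/N) ∈ [4, 2π)` in units of the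
inverse torus side `1/ℓ` — the same units in which the zero-flux zero-mode levels are `ε·λ`, `λ = g(ℓ)^{2/3} → 0`
(`ZeroModeAsymptotics`).  So the Born–Oppenheimer separation of R2b′'s last step is `λ` against a kinematic `≥ 4/ℓ`, WHATEVER the side
`N` (in current lattice units) at which the constant modes are split off (Jordan's inequality; `sin x < x`).
[cite: Vanbaal2001, §4 (non-zero momentum modes at energies O(1/L) against the O(g^{2/3}/L) zero-mode levels)] -/
theorem kkMass_scaled {N : ℕ} (h2 : 2 ≤ N) :
    4 ≤ 2 * (N : ℝ) * Real.sin (Real.pi / N) ∧ 2 * (N : ℝ) * Real.sin (Real.pi / N) < 2 * Real.pi := by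
  have hN : (2 : ℝ) ≤ N := by exact_mod_cast h2
  have hN0 : (0 : ℝ) < N := by linarith
  have hx0 : 0 < Real.pi / N := div_pos Real.pi_pos hN0
  have hx2 : Real.pi / N ≤ Real.pi / 2 := div_le_div_of_nonneg_left Real.pi_pos.le (by norm_num) hN
  have h2N : (0 : ℝ) < 2 * N := by positivity
  refine ⟨?_, ?_⟩
  · have h := Real.mul_le_sin hx0.le hx2
    have h' : 2 / Real.pi * (Real.pi / N) = 2 / N := by
      field_simp
    rw [h'] at h
    have h4 : 2 * (N : ℝ) * (2 / N) = 4 := by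
      field_simp
      ring
    calc (4 : ℝ) = 2 * (N : ℝ) * (2 / N) := h4.symm
      _ ≤ 2 * (N : ℝ) * Real.sin (Real.pi / N) := mul_le_mul_of_nonneg_left h h2N.le
  · have h := Real.sin_lt hx0
    have h' : 2 * (N : ℝ) * (Real.pi / N) = 2 * Real.pi := by
      field_simp
    calc 2 * (N : ℝ) * Real.sin (Real.pi / N) < 2 * (N : ℝ) * (Real.pi / N) := mul_lt_mul_of_pos_left h h2N
      _ = 2 * Real.pi := h'

/-- … in particular the kinematic-to-dynamical ratio is at least `4/(E·λ)` for a zero-mode level `E·λ` (`E > 0`, `0 < λ`):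
the number R2b′'s Born–Oppenheimer step consumes (ROUTE-P1.md §17.5). [cite: Vanbaal2001, §4] -/
theorem kk_over_zeroMode {N : ℕ} (h2 : 2 ≤ N) {E lam : ℝ} (hE : 0 < E) (hlam : 0 < lam) :
    4 / (E * lam) ≤ 2 * (N : ℝ) * Real.sin (Real.pi / N) / (E * lam) :=
  div_le_div_of_nonneg_right (kkMass_scaled h2).1 (mul_pos hE hlam).le

end Budget

end Literature.MathematicalPhysics.QuantumFieldTheory.Balaban1983to89.FemtoUniverseGap
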